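import Mathlib
import Summits.Ventures.PercRepro2.LeafAA0

/-!
# Leaf and coincidence reductions of the candidate «(AA0)» (blind cell PercRepro2, p5 g27;
`proofs/P5-OEDGE.md` §33 addendum 4 (3), `proofs/subclaims/S4-HARDSTEP.md` v110 §2.4 (s))

The candidate (AA0) of row (LEAF-½) is `0 ≤ crossAA p ends o a₁ a₂ v b` (`LeafAA0.lean`), with
`crossAA = Z³·(E_Q[(L_b − β)(L_o − l) H_v] + E_Q[(H_b − β′)(H_o − c) L_v])`. This file settles it
whenever the explored mark `v` is degenerate:

* **`v` a leaf** (`v` hangs at `w` by the single edge `f`, `q = p f`): every `v`-mass is `q` times the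
  `w`-mass (`prob_Q_conn_leaf`), so `crossA` and `crossAA` at `v` are `q` times their values at `w`
  (`crossA_leaf`, `crossAA_leaf`) — (AA0) at the leaf `v` follows from (AA0) at its attachment
  vertex (`crossAA_nonneg_leaf_of`), and (LEAF-½) at `v` from (AA0) at `w` (`LeafRow_leaf_of_AA0`);
* **`v` a root**: `crossA(v = a₂) = Z·C(oL, bL)` (BHK same cluster) and `crossA(v = a₁) = 0`
  (`crossA_root`, `crossA_root'`), hence `0 ≤ crossAA` (`crossAA_root_nonneg`,
  `crossAA_root'_nonneg`);
* **`v = b` or `v = o`**: `crossA = P(Q, bL)·anticov(oL, bH)` resp. `P(Q, oL)·anticov(oH, bL)`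
  (BHK 1.4 cross cluster; `crossA_mark_b`, `crossA_mark_o`), hence `0 ≤ crossAA`
  (`crossAA_mark_b_nonneg`, `crossAA_mark_o_nonneg`).

Consequently row (LEAF-½) is a theorem at every leaf `v` attached to a mark (`LeafRow_leaf_root`,
`LeafRow_leaf_root'`, `LeafRow_leaf_b`, `LeafRow_leaf_o`), and the open content of (AA0) sits at
explored vertices `v` of degree `≥ 2` that are not marks. Nothing here claims `0 ≤ crossAA` in general.
-/

namespace Summit.Ventures.PercRepro2

open UnionCluster CovForm PendantRoot PendantO LeafStep

namespace LeafHalfCross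

variable {V : Type*} {E : Type*} [Fintype E] [DecidableEq E] [Fintype V] [DecidableEq V]
  {R : Type*} [Field R] [LinearOrder R] [IsStrictOrderedRing R]

section Empty

variable (ends : E → Sym2 V)

omit [Fintype E] [DecidableEq E] [Fintype V] [DecidableEq V] in
/-- `{a ↔ a}` is the sure event. -/
private lemma connEvent_self_univ (a : V) : connEvent ends a a = Set.univ := by
  ext ω
  simp only [mem_connEvent, Set.mem_univ, iff_true]
  exact conn_refl ends ω a

omit [Fintype E] [DecidableEq E] [Fintype V] [DecidableEq V] in
/-- Under `Q = {a₁ ↮ a₂}` the root `a₁` is not in `C₂`. -/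
private lemma Q_inter_conn_roots (a₁ a₂ : V) (Y : Set (Config E)) :
    avoidAll ends a₂ {a₁} ∩ (connEvent ends a₂ a₁ ∩ Y) = ∅ := by
  ext ω
  simp only [Set.mem_inter_iff, avoidAll, Set.mem_setOf_eq, Finset.mem_singleton, forall_eq,
    mem_connEvent, Set.mem_empty_iff_false, iff_false, not_and]
  intro hQ h _
  exact hQ h

end Empty

/-! ## The masses of a leaf `v` -/

section Leaf

variable (p : E → R) (ends : E → Sym2 V) {f : E} {v w : V}

omit [Fintype V] [DecidableEq V] [LinearOrder R] [IsStrictOrderedRing R] in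
/-- **The `C₂`-mass of a leaf**: for `v` hanging at `w` by `f` and an `f`-free `X`,
`P(Q, v ∈ C₂, X) = q · P(Q, w ∈ C₂, X)`. -/
lemma prob_Q_conn_leaf (hf : ends f = s(v, w)) (hleaf : ∀ e, v ∈ ends e → e = f) (hvw : v ≠ w)
    {a₁ a₂ : V} (h1 : v ≠ a₁) (h2 : v ≠ a₂) {X : Set (Config E)} (hX : Free f X) :
    prob p (avoidAll ends a₂ {a₁} ∩ (connEvent ends a₂ v ∩ X)) =
      p f * prob p (avoidAll ends a₂ {a₁} ∩ (connEvent ends a₂ w ∩ X)) := by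
  rw [← prob_T_inter_v, prob_T_inter_o p hf hleaf hvw h1 h2 hX]

omit [Fintype V] [DecidableEq V] [LinearOrder R] [IsStrictOrderedRing R] in
/-- **The `C₂`-mass of a leaf, no further event**: `P(Q, v ∈ C₂) = q · P(Q, w ∈ C₂)`. -/
lemma prob_Q_conn_leaf_univ (hf : ends f = s(v, w)) (hleaf : ∀ e, v ∈ ends e → e = f) (hvw : v ≠ w)
    {a₁ a₂ : V} (h1 : v ≠ a₁) (h2 : v ≠ a₂) :
    prob p (avoidAll ends a₂ {a₁} ∩ connEvent ends a₂ v) =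
      p f * prob p (avoidAll ends a₂ {a₁} ∩ connEvent ends a₂ w) := by
  have h := prob_Q_conn_leaf p ends hf hleaf hvw h1 h2 (X := Set.univ) free_univ
  rwa [Set.inter_univ, Set.inter_univ] at h

omit [Fintype V] [DecidableEq V] [LinearOrder R] [IsStrictOrderedRing R] in
/-- **`crossA` at a leaf**: `crossA(v) = q · crossA(w)` for `v ∉ {o, b, a₁, a₂}` a leaf at `w`. -/
theorem crossA_leaf (hf : ends f = s(v, w)) (hleaf : ∀ e, v ∈ ends e → e = f) (hvw : v ≠ w)
    {o a₁ a₂ b : V} (h1 : v ≠ a₁) (h2 : v ≠ a₂) (ho : o ≠ v) (hb : b ≠ v) :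
    crossA p ends o a₁ a₂ v b = p f * crossA p ends o a₁ a₂ w b := by
  have c₁o : Free f (connEvent ends a₁ o) := free_connEvent hf hleaf hvw (Ne.symm h1) ho
  have c₁b : Free f (connEvent ends a₁ b) := free_connEvent hf hleaf hvw (Ne.symm h1) hb
  unfold crossA anticov
  rw [prob_Q_conn_leaf p ends hf hleaf hvw h1 h2 (c₁o.inter c₁b),
    prob_Q_conn_leaf p ends hf hleaf hvw h1 h2 c₁o, prob_Q_conn_leaf p ends hf hleaf hvw h1 h2 c₁b,
    prob_Q_conn_leaf_univ p ends hf hleaf hvw h1 h2]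
  ring

omit [Fintype V] [DecidableEq V] [LinearOrder R] [IsStrictOrderedRing R] in
/-- **`crossAA` at a leaf**: `crossAA(v) = q · crossAA(w)` for `v ∉ {o, b, a₁, a₂}` a leaf at `w`. -/
theorem crossAA_leaf (hf : ends f = s(v, w)) (hleaf : ∀ e, v ∈ ends e → e = f) (hvw : v ≠ w)
    {o a₁ a₂ b : V} (h1 : v ≠ a₁) (h2 : v ≠ a₂) (ho : o ≠ v) (hb : b ≠ v) :
    crossAA p ends o a₁ a₂ v b = p f * crossAA p ends o a₁ a₂ w b := by
  unfold crossAA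
  rw [crossA_leaf p ends hf hleaf hvw h1 h2 ho hb, crossA_leaf p ends hf hleaf hvw h2 h1 ho hb]
  ring

omit [Fintype V] [DecidableEq V] in
/-- **(AA0) descends to leaves**: (AA0) at the attachment vertex `w` gives (AA0) at the leaf `v`. -/
theorem crossAA_nonneg_leaf_of (hp : IsProbVec p) (hf : ends f = s(v, w))
    (hleaf : ∀ e, v ∈ ends e → e = f) (hvw : v ≠ w) {o a₁ a₂ b : V} (h1 : v ≠ a₁) (h2 : v ≠ a₂)
    (ho : o ≠ v) (hb : b ≠ v) (hw : 0 ≤ crossAA p ends o a₁ a₂ w b) :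
    0 ≤ crossAA p ends o a₁ a₂ v b := by
  rw [crossAA_leaf p ends hf hleaf hvw h1 h2 ho hb]
  exact mul_nonneg (hp.nonneg f) hw

/-- **Row (LEAF-½) at a leaf from (AA0) at its attachment vertex.** -/
theorem LeafRow_leaf_of_AA0 (hp : IsProbVec p) (hf : ends f = s(v, w))
    (hleaf : ∀ e, v ∈ ends e → e = f) (hvw : v ≠ w) {o a₁ a₂ b : V} (h1 : v ≠ a₁) (h2 : v ≠ a₂)
    (ho : o ≠ v) (hb : b ≠ v) (hw : 0 ≤ crossAA p ends o a₁ a₂ w b) :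
    LeafRow p ends o a₁ a₂ v b :=
  LeafRow_of_AA0 p ends hp o a₁ a₂ v b (crossAA_nonneg_leaf_of p ends hp hf hleaf hvw h1 h2 ho hb hw)

end Leaf

/-! ## The coincidences `v ∈ {a₁, a₂, b, o}` -/

section Coincidence

variable (p : E → R) (ends : E → Sym2 V)

omit [Fintype V] [DecidableEq V] [LinearOrder R] [IsStrictOrderedRing R] in
/-- **`crossA` at `v = a₂`**: `crossA(o, a₁, a₂, a₂, b) = P(Q) · C(oL, bL)` (the same-cluster
covariance of `PendantRoot.covC`). -/
theorem crossA_root (o a₁ a₂ b : V) :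
    crossA p ends o a₁ a₂ a₂ b =
      prob p (avoidAll ends a₂ {a₁}) *
        covC p ends a₁ a₂ (connEvent ends a₁ o) (connEvent ends a₁ b) := by
  unfold crossA anticov covC
  simp only [connEvent_self_univ, Set.univ_inter, Set.inter_univ]
  ring

omit [Fintype V] [DecidableEq V] [LinearOrder R] [IsStrictOrderedRing R] in
/-- **`crossA` at `v = a₁`**: `crossA(o, a₁, a₂, a₁, b) = 0` (`a₁ ∉ C₂` under `Q`). -/
theorem crossA_root' (o a₁ a₂ b : V) : crossA p ends o a₁ a₂ a₁ b = 0 := by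
  unfold crossA anticov
  have h₁ := Q_inter_conn_roots ends a₁ a₂ (connEvent ends a₁ o ∩ connEvent ends a₁ b)
  have h₂ := Q_inter_conn_roots ends a₁ a₂ (connEvent ends a₁ o)
  have h₃ := Q_inter_conn_roots ends a₁ a₂ (connEvent ends a₁ b)
  have h₄ : avoidAll ends a₂ {a₁} ∩ connEvent ends a₂ a₁ = ∅ := by
    have := Q_inter_conn_roots ends a₁ a₂ Set.univ
    rwa [Set.inter_univ] at this
  rw [h₁, h₂, h₃, h₄, prob_empty]
  ring

/-- **(AA0) at `v = a₂`**: `0 ≤ crossAA(o, a₁, a₂, a₂, b)`. -/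
theorem crossAA_root_nonneg (hp : IsProbVec p) (o a₁ a₂ b : V) :
    0 ≤ crossAA p ends o a₁ a₂ a₂ b := by
  unfold crossAA
  rw [crossA_root, crossA_root' p ends o a₂ a₁ b, add_zero]
  exact mul_nonneg (prob_nonneg hp _) (covC_same_nonneg p ends hp o a₁ a₂ b)

/-- **(AA0) at `v = a₁`**: `0 ≤ crossAA(o, a₁, a₂, a₁, b)`. -/
theorem crossAA_root'_nonneg (hp : IsProbVec p) (o a₁ a₂ b : V) :
    0 ≤ crossAA p ends o a₁ a₂ a₁ b := by
  unfold crossAA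
  rw [crossA_root', crossA_root p ends o a₂ a₁ b, zero_add]
  exact mul_nonneg (prob_nonneg hp _) (covC_same_nonneg p ends hp o a₂ a₁ b)

omit [Fintype V] [DecidableEq V] [LinearOrder R] [IsStrictOrderedRing R] in
/-- **`crossA` at `v = b`**: `crossA(o, a₁, a₂, b, b) = P(Q, bL) · anticov(oL, bH)`. -/
theorem crossA_mark_b (o a₁ a₂ b : V) :
    crossA p ends o a₁ a₂ b b =
      prob p (avoidAll ends a₂ {a₁} ∩ connEvent ends a₁ b) *
        anticov p ends a₁ a₂ (connEvent ends a₁ o) (connEvent ends a₂ b) := by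
  unfold crossA anticov
  rw [PendantB.Q_inter_both_last' ends a₁ a₂ b (connEvent ends a₁ o), Q_inter_both_eq_empty₂' ends a₁ a₂ b,
    prob_empty, Set.inter_comm (connEvent ends a₂ b) (connEvent ends a₁ o)]
  ring

omit [Fintype V] [DecidableEq V] [LinearOrder R] [IsStrictOrderedRing R] in
/-- **`crossA` at `v = o`**: `crossA(o, a₁, a₂, o, b) = P(Q, oL) · anticov(oH, bL)`. -/
theorem crossA_mark_o (o a₁ a₂ b : V) :
    crossA p ends o a₁ a₂ o b =
      prob p (avoidAll ends a₂ {a₁} ∩ connEvent ends a₁ o) *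
        anticov p ends a₁ a₂ (connEvent ends a₂ o) (connEvent ends a₁ b) := by
  unfold crossA anticov
  rw [Q_inter_both_eq_empty' ends a₁ a₂ o (connEvent ends a₁ b), Q_inter_both_eq_empty₂' ends a₁ a₂ o,
    prob_empty]
  ring

/-- **(AA0) at `v = b`**: `0 ≤ crossAA(o, a₁, a₂, b, b)` (two cross-cluster anticovariances). -/
theorem crossAA_mark_b_nonneg (hp : IsProbVec p) (o a₁ a₂ b : V) :
    0 ≤ crossAA p ends o a₁ a₂ b b := by
  unfold crossAA
  rw [crossA_mark_b, crossA_mark_b p ends o a₂ a₁ b]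
  exact add_nonneg (mul_nonneg (prob_nonneg hp _) (anticov_nonneg_of_cross p ends hp a₁ a₂ o b))
    (mul_nonneg (prob_nonneg hp _) (anticov_nonneg_of_cross p ends hp a₂ a₁ o b))

/-- **(AA0) at `v = o`**: `0 ≤ crossAA(o, a₁, a₂, o, b)` (two cross-cluster anticovariances). -/
theorem crossAA_mark_o_nonneg (hp : IsProbVec p) (o a₁ a₂ b : V) :
    0 ≤ crossAA p ends o a₁ a₂ o b := by
  unfold crossAA
  rw [crossA_mark_o, crossA_mark_o p ends o a₂ a₁ b]
  exact add_nonneg (mul_nonneg (prob_nonneg hp _) (anticov_nonneg_of_cross' p ends hp a₁ a₂ o b))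
    (mul_nonneg (prob_nonneg hp _) (anticov_nonneg_of_cross' p ends hp a₂ a₁ o b))

end Coincidence

/-! ## Row (LEAF-½) at a leaf attached to a mark -/

section LeafAtMark

variable (p : E → R) (ends : E → Sym2 V) {f : E} {v : V}

/-- **(LEAF-½) at a leaf `v` hanging at the root `a₂`.** -/
theorem LeafRow_leaf_root (hp : IsProbVec p) {o a₁ a₂ b : V} (hf : ends f = s(v, a₂))
    (hleaf : ∀ e, v ∈ ends e → e = f) (h1 : v ≠ a₁) (h2 : v ≠ a₂) (ho : o ≠ v) (hb : b ≠ v) :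
    LeafRow p ends o a₁ a₂ v b :=
  LeafRow_leaf_of_AA0 p ends hp hf hleaf h2 h1 h2 ho hb (crossAA_root_nonneg p ends hp o a₁ a₂ b)

/-- **(LEAF-½) at a leaf `v` hanging at the root `a₁`.** -/
theorem LeafRow_leaf_root' (hp : IsProbVec p) {o a₁ a₂ b : V} (hf : ends f = s(v, a₁))
    (hleaf : ∀ e, v ∈ ends e → e = f) (h1 : v ≠ a₁) (h2 : v ≠ a₂) (ho : o ≠ v) (hb : b ≠ v) :
    LeafRow p ends o a₁ a₂ v b :=
  LeafRow_leaf_of_AA0 p ends hp hf hleaf h1 h1 h2 ho hb (crossAA_root'_nonneg p ends hp o a₁ a₂ b)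

/-- **(LEAF-½) at a leaf `v` hanging at `b`.** -/
theorem LeafRow_leaf_b (hp : IsProbVec p) {o a₁ a₂ b : V} (hf : ends f = s(v, b))
    (hleaf : ∀ e, v ∈ ends e → e = f) (h1 : v ≠ a₁) (h2 : v ≠ a₂) (ho : o ≠ v) (hb : b ≠ v) :
    LeafRow p ends o a₁ a₂ v b :=
  LeafRow_leaf_of_AA0 p ends hp hf hleaf (Ne.symm hb) h1 h2 ho hb
    (crossAA_mark_b_nonneg p ends hp o a₁ a₂ b)

/-- **(LEAF-½) at a leaf `v` hanging at `o`.** -/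
theorem LeafRow_leaf_o (hp : IsProbVec p) {o a₁ a₂ b : V} (hf : ends f = s(v, o))
    (hleaf : ∀ e, v ∈ ends e → e = f) (h1 : v ≠ a₁) (h2 : v ≠ a₂) (ho : o ≠ v) (hb : b ≠ v) :
    LeafRow p ends o a₁ a₂ v b :=
  LeafRow_leaf_of_AA0 p ends hp hf hleaf (Ne.symm ho) h1 h2 ho hb
    (crossAA_mark_o_nonneg p ends hp o a₁ a₂ b)

end LeafAtMark

end LeafHalfCross

end Summit.Ventures.PercRepro2
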